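import Summits.BirchSwinnertonDyer.BirchSwinnertonDyer.Theorems.PrintCf2SplitBadTwoKummerEtaleConjTransport
import Summits.BirchSwinnertonDyer.BirchSwinnertonDyer.Theorems.PrintCf2SplitBadTwoETHolds
import HarnessLib

/-!
# Crux `PrintCf2.SplitBadTwoRankOneOfFacts` (stmt-BirchSwinnertonDyer-20368), skeleton v12, brick (FIN) CLOSED: Agboola's restricted Selmer group
# `𝔖_{v̄}(K, W*)` at level `K` is FINITE on every road-α frame carrying `Finite W.sha` and the `ℚ`-generator datum — no displayed hypothesis left

Cell `bsd-print-cf2`, width seat `bsd-line-cf2c-w2` g2 (prover-bsd-line-cf2c-w2-g2-0); `--supports stmt-BirchSwinnertonDyer-20368` (helper). ONE-LINE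
composition of two tree theorems whose owners' seats have ended: -w4 g10's p686044
`RelaxationLift.finite_restrictedSelmerBase_of_finite_sha_of_etale_at_v` ((FIN) modulo the étale brick (ET-v), stated with (ET-v) as its LAST displayed
hypothesis) and -w3 g10's p687682 `CMPrimes.hET_holds` ((ET-v) on the pinned frame, hypothesis-free). HONEST FRAMING: nothing here closes the crux
or a registered stub; BSD is not proved by any of this; no summit statement is proved by this seat. No definition, no named fact, no `sorry`.

* **`finite_restrictedSelmerBase_of_frame`** — binders = p686044's VERBATIM minus the (ET-v) clause: for every member `C • W = cm7^{(d)}` (`d ≠ 0`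
  squarefree, `d % 4 ≠ 1`, analytic rank one, `Finite W.sha`), `K` imaginary quadratic with `2 = v v̄`, `π² = π − 2`, `r² = r − 2`, the pinning clause
  at `v` for `W* = ↥((W.baseChange K).endEigenPrimaryTorsion 2 π r)`, and the `ℚ`-generator datum `(P, c₀, ℓ)`:
  **`Finite (restrictedSelmerBase W* 2 v̄)`**, i.e. `𝔖_{v̄}(K, W*)` is finite. This is the (FIN) input of S3b′-v12 / S3d (`stub_strictDefectAtVbar_two`)
  and the `hB`/`hfin` of cf2c-w3's `RubinValueTwoRestrictedCut.exists_hasCharValuationAt_of_finite_restrictedSelmerBase`, of -w5's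
  `finite_endInvariants_of_frame_of_finite_restrictedSelmerBase` and of B17's `locSurj_of_proj … _of_conjFiniteness`.
* Consumers by name: cf2c-w3 p681000 `RubinValueTwoRestrictedCut.exists_hasCharValuationAt_of_finite_restrictedSelmerBase … (this …)` gives, for THE line
  `κ'` unramified outside `v̄` and EVERY Agboola dual datum `D` of `𝔖_{v̄}(K*_∞, W*)`, `Module.Finite Λ D.X ∧ ∃ n, D.HasCharValuationAt n` on the frame.
presearch: not applicable (composition of tree theorems; Agboola 2007 §6 Thm. 6.12 «assume Ш(K)(𝔭*) finite», Greenberg LNM 1716 §2, §4 Lemma 4.2 —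
held and cited by the composed lemmas). beyond-print theorem: no.

References: [Agboola2007] §5, §6 Prop. 6.10–6.12; [GreenbergLNM1716] §2, §4 Lemma 4.2; [Rubin1992] (p-adic L-functions and rational points) §3.
-/

noncomputable section

open scoped Classical
-- the summit namespace `Summit.BirchSwinnertonDyer.BirchSwinnertonDyer` repeats the problem name by design (D-0017)
set_option linter.dupNamespace false
set_option autoImplicit false

open NumberField IsDedekindDomain Field WeierstrassCurve
open Literature.NumberTheory.EllipticCurves Literature.NumberTheory.EllipticCurves.GreenbergSelmer
open Literature.NumberTheory.EllipticCurves.Agboola2007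
open Literature.NumberTheory.EllipticCurves.Rank1Residual
open Literature.NumberTheory.GaloisRepresentations

namespace Summit.BirchSwinnertonDyer.BirchSwinnertonDyer.Theorems.PrintCf2.RelaxationLift

/-- **(FIN) ON EVERY FRAME, NO DISPLAYED HYPOTHESIS: `𝔖_{v̄}(K, W*)` is finite.** For every member `C • W = cm7^{(d)}` (`d ≠ 0` squarefree, `d % 4 ≠ 1`,
`W/ℚ` globally minimal of analytic rank one with `Finite W.sha`), every imaginary quadratic `K` with `2 = v v̄`, every `K`-rational `π` with `π² = π − 2`,
`r ∈ ℤ₂` with `r² = r − 2` and the pinning clause at `v` for `W* = ↥((W.baseChange K).endEigenPrimaryTorsion 2 π r)`, and every `ℚ`-generator datum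
`(P, c₀, ℓ)` (`P` of infinite order generating modulo torsion, `c₀ P` in the `2`-adic reduction kernel with `‖log(c₀P)/c₀‖ = 2^{−ℓ}`): Agboola's restricted
Selmer group at level `K` is FINITE. Proof: -w4 g10's `finite_restrictedSelmerBase_of_finite_sha_of_etale_at_v` (Ш(W_K)[2^∞] finite from `Finite W.sha`;
the Mordell–Weil line is killed at `v̄` because `log P ≠ 0`; the relaxed-at-`v` excess is controlled by the étale brick) with its last hypothesis (ET-v)
supplied by -w3 g10's `CMPrimes.hET_holds`. Agboola 2007 Thm. 6.12's standing assumption «Ш(K)(𝔭*) finite ⟹ `𝔖_{𝔭*}(K, W*)` finite in rank one».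
[cite: Agboola2007, §6 Prop. 6.10–6.12] [cite: GreenbergLNM1716, §2 Prop. 2.1–2.2] -/
theorem finite_restrictedSelmerBase_of_frame :
    ∀ (d : ℤ), d ≠ 0 → Squarefree d → d % 4 ≠ 1 →
      ∀ (W : WeierstrassCurve ℚ) [W.IsElliptic] [W.IsGloballyMinimal] (C : VariableChange ℚ),
        C • W = cm7.quadraticTwist (d : ℚ) → W.analyticRank = 1 →
        Finite W.sha →
      ∀ (K : Type) [Field K] [NumberField K], IsImaginaryQuadratic K →
      ∀ (v vbar : HeightOneSpectrum (𝓞 K)),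
        ((2 : ℕ) : 𝓞 K) ∈ v.asIdeal → ((2 : ℕ) : 𝓞 K) ∈ vbar.asIdeal → vbar ≠ v →
      ∀ (π : (W.baseChange K).endRing), (π : AddMonoid.End (W.baseChange K).geomPoints) * π = π - 2 →
      ∀ (r : ℤ_[2]), r * r = r - 2 →
        (∀ τ ∈ GreenbergSelmer.inertia v, ∀ x : ↥((W.baseChange K).endEigenPrimaryTorsion 2 π r), τ • x = x ∨ τ • x = -x) →
      ∀ (P : W.toAffine.Point) (c₀ : ℕ) (ℓ : ℤ),
        ¬ IsOfFinAddOrder P →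
        (∀ R : W.toAffine.Point, ∃ (k : ℤ) (T : W.toAffine.Point), IsOfFinAddOrder T ∧ R = k • P + T) →
        c₀ ≠ 0 → (W.baseChange ℚ_[2]).IsInReductionKernel (c₀ • W.toPadicPoint 2 P) →
        ‖(W.baseChange ℚ_[2]).padicLogPoint (c₀ • W.toPadicPoint 2 P) / (c₀ : ℚ_[2])‖ = (2 : ℝ) ^ (-ℓ) →
      Finite (restrictedSelmerBase ↥((W.baseChange K).endEigenPrimaryTorsion 2 π r) 2 vbar) := by
  intro d hd0 hsq hd4 W _ _ C hC hrank hsha K _ _ hK v vbar hv hvbar hne π hrel r hr hpin P c₀ ℓ hP hgen hc₀ hker hlog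
  exact finite_restrictedSelmerBase_of_finite_sha_of_etale_at_v d hd0 hsq hd4 W C hC hrank hsha K hK v vbar hv hvbar hne π hrel r hr hpin
    P c₀ ℓ hP hgen hc₀ hker hlog (CMPrimes.hET_holds hd0 hsq hd4 W C hC hK v vbar hv hvbar hne π hrel hr hpin)

end Summit.BirchSwinnertonDyer.BirchSwinnertonDyer.Theorems.PrintCf2.RelaxationLift
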